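import Summits.QuantumAdvantage.QuantumAdvantage.Theses.CubicForrelation
import Literature.Computability.QuantumComplexity.SignedCubicForrelation
import Summits.QuantumAdvantage.QuantumAdvantage.Theorems.CubicForrelationSignedExactCubicForrelationNotPrBPPStubNoTrapTransportLemmas
import Summits.QuantumAdvantage.QuantumAdvantage.Theorems.CubicForrelationSignedExactCubicForrelationNotPrBPPStubDualShape
import Summits.QuantumAdvantage.QuantumAdvantage.Theorems.CubicForrelationNearExactIsExactDerivDegree
import Summits.QuantumAdvantage.QuantumAdvantage.Theorems.CubicForrelationNearExactIsExactMmFormCeilingA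

/-!
# Crux `CubicForrelation.SignedExactCubicForrelationNotPrBPP` (stmt-QuantumAdvantage-13932) — stub `stub_noTrapTransport`

Line `dual-pingpong-frame` (GROW reshape): the NO-TRAP THEOREM is COVARIANT. Assuming the no-trap theorem in
Maiorana–McFarland TEMPLATE coordinates (`b = y'·π(y'') ⊕ h(y'')`, `a = x''·π⁻¹(x') ⊕ h(π⁻¹ x') ⊕ c`; this is the
landed stub `stub_noTrapTemplate`, taken here as the antecedent of the implication), it holds for every exactly
forrelated cubic pair `(a, b)` (`Φ(a, b) = ±1`) whose `b` lies on a completed Maiorana–McFarland ORBIT: `b ∘ e` is a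
template for an affine bijection `e y = M y + c` of `𝔽₂^{m+m}`. Conclusion in both: every pair of subspaces `(S, U)`
that is closed for `b` from `S` into `U`, closed for `a` from `U` into `S` and orthogonal extends to an M-subspace
`V ⊇ S` of `b` with `V ⊥ U`.

Proof (covariance bookkeeping; generic helper file `…StubNoTrapTransportLemmas.lean`).
1. Linear part `L y := e y ⊕ c` (additive, `Covariance.additive_linear_part`), inverse `L⁻¹ x := e⁻¹(x ⊕ c)`, adjoint
   `Lᵀ` (`L x · y = x · Lᵀ y`, `Covariance.exists_adjoint`) and `L⁻ᵀ :=` the adjoint of `L⁻¹`, a two-sided inverse of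
   `Lᵀ` by nondegeneracy of the inner product bit.
2. `b₀ := b ∘ e` is the Boolean template `y'·perm(y'') ⊕ h(y'')` and is cubic; `a₀ x := a(L⁻ᵀ x) ⊕ (L⁻ᵀ x)·c` is
   cubic; `Φ(a₀, b₀) = Φ(a, b) = ±1` (`Covariance.forrelation_transport`), so McFarland's dual formula
   (`stub_dualShape`) gives `a₀ = x''·perm⁻¹(x') ⊕ h(perm⁻¹ x') ⊕ c₀`; the coordinates of `perm`, `perm⁻¹` are first
   derivatives of the cubics `b₀`, `a₀`, hence quadratic.
3. Transport `(S, U) ↦ (S₀, U₀) := (L⁻¹ S, Lᵀ U)`: subspaces, orthogonal (`L⁻¹s · Lᵀu = s · u`), closed for `b₀` and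
   for `a₀` (`Covariance.closedF_transport`: second differences are covariant, third differences of cubics are
   base-point free, rows transform by the adjoint, offsets by the adjoint of the representing vector).
4. The hypothesis yields an M-subspace `V₀ ⊇ S₀` of `b₀` with `V₀ ⊥ U₀`; then `V := L V₀` is an M-subspace of `b`
   (`|V| = |V₀|`, `D_{Lu} D_{Lv} b (x) = D_u D_v b₀ (e⁻¹ x) = 0`), contains `S = L L⁻¹ S` and is orthogonal to `U`
   (`L v · u = v · Lᵀ u = 0`).

Orbit-specific lemmas proved first (namespace `Covariance`, no definitions):
* `additive_linear_part`: the linear part `L y := e y ⊕ c` of `e y = M y + c` is additive (read through `QuadSampler.bz`);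
* `template_bool`: the `ZMod 2` template identity is the Boolean one, `b ∘ e (y', y'') = y'·perm(y'') ⊕ h(y'')`;
* `forrelation_transport`: AFFINE COVARIANCE OF `Φ` — for `e y = L y ⊕ c`, `L x · y = x · Lᵀ y` and `L⁻ᵀ` a two-sided
  inverse of `Lᵀ`, the pair `b₀ := b ∘ e`, `a₀ := x ↦ a(L⁻ᵀ x) ⊕ (L⁻ᵀ x)·c` has `Φ(a₀, b₀) = Φ(a, b)` (reindex the double
  character sum by `e` and `L⁻ᵀ`; `(-1)^{L⁻ᵀx · (Ly ⊕ c)} = (-1)^{x·y} (-1)^{L⁻ᵀx·c}`);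
* `isDegLeFun_two_perm`, `isDegLeFun_two_symm`: the coordinates of `perm` (of `perm⁻¹`) are first derivatives of the
  cubic `b₀` (of the cubic dual template `a₀`) restricted to a block, hence quadratic
  (`NearExactIsExact.stub_derivDegree`, `knf_isDegLeFun_comp`, `NearExactIsExact.fc_deg_coord_append_left`).

References: C. Carlet, *Boolean Functions for Cryptography and Coding Theory*, CUP 2020, §2.2.2 (affine equivalence,
derivatives), Prop. 54, Prop. 77 [Carlet2020]; S. Aaronson, A. Ambainis, Forrelation, SIAM J. Comput. 47 (2018), §1.1.1
[AaronsonAmbainis2018]; R. O'Donnell, *Analysis of Boolean Functions*, CUP 2014, §3.3 [ODonnell2014].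
-/

noncomputable section

set_option linter.dupNamespace false -- D-0017: single-problem summit ⇒ `QuantumAdvantage.QuantumAdvantage` by design

namespace Summit.QuantumAdvantage.QuantumAdvantage.Theorems.SignedExactCubicForrelationNotPrBPP

open Finset
open Literature.Computability.Complexity Literature.Computability.QuantumComplexity
open Literature.Computability.QuantumComplexity.BuzetChailloux (bxor zeroVec bxor_self bxor_comm
  bxor_zeroVec zeroVec_bxor twist_bxor_right)
open Literature.Computability.Complexity.BLR (toZ toZ_xor toZ_and toZ_injective)
open PolarGeometry (toZ_bdot bdot_comm bdot_bxor_left bdot_bxor_right bxor_append)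
open NoTrap (bdot_unit bdot_zeroVec)
open Summit.QuantumAdvantage.QuantumAdvantage.Theorems.SignedCubicForrelationNotPrBPP (knf_isDegLeFun_comp
  knf_isDegLeFun_xor')
open Summit.QuantumAdvantage.QuantumAdvantage.Theorems.CubicForrelation.NearExactIsExact (stub_derivDegree
  fc_deg_coord_append_left)
open Covariance

namespace Covariance

variable {m n : ℕ}

/-! ### The orbit datum: linear part and Boolean template -/

/-- **The linear part of an affine bijection is additive**: if `e y = M y + c` over `ZMod 2` (coordinates read
through `[·]`), then `L y := e y ⊕ [c = 1]` satisfies `L (x ⊕ y) = L x ⊕ L y`. [folklore] -/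
theorem additive_linear_part (e : (Fin n → Bool) → (Fin n → Bool)) (M : Matrix (Fin n) (Fin n) (ZMod 2))
    (c : Fin n → ZMod 2)
    (hM : ∀ y i, (if e y i then (1 : ZMod 2) else 0) = (M.mulVec (fun j => if y j then (1 : ZMod 2) else 0) + c) i) :
    ∀ x y, bxor (e (bxor x y)) (fun i => decide (c i = 1)) =
      bxor (bxor (e x) (fun i => decide (c i = 1))) (bxor (e y) (fun i => decide (c i = 1))) := by
  have hbz : ∀ y, QuadSampler.bz (bxor (e y) (fun i => decide (c i = 1))) = M.mulVec (QuadSampler.bz y) := by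
    intro y
    funext i
    show toZ (e y i ^^ decide (c i = 1)) = M.mulVec (fun j => toZ (y j)) i
    rw [toZ_xor, QuadPolar.toZ_decide_eq_one]
    have key := hM y i
    change toZ (e y i) = (M.mulVec (fun j => toZ (y j)) + c) i at key
    rw [key, Pi.add_apply, add_assoc, CharTwo.add_self_eq_zero, add_zero]
  intro x y
  apply QuadSampler.bz_injective
  have e1 : QuadSampler.bz (bxor (bxor (e x) (fun i => decide (c i = 1))) (bxor (e y) (fun i => decide (c i = 1)))) =
      QuadSampler.bz (bxor (e x) (fun i => decide (c i = 1))) + QuadSampler.bz (bxor (e y) (fun i => decide (c i = 1))) :=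
    QuadSampler.bz_xorVec _ _
  have e2 : QuadSampler.bz (bxor x y) = QuadSampler.bz x + QuadSampler.bz y := QuadSampler.bz_xorVec _ _
  rw [e1, hbz, hbz, hbz, e2, Matrix.mulVec_add]

/-- **The `ZMod 2` template identity is the Boolean one**: `[g(y', y'')] = ∑ᵢ [y'ᵢ][perm(y'')ᵢ] + [h y'']` over
`ZMod 2` says `g(y', y'') = y'·perm(y'') ⊕ h(y'')` with the inner product bit. [cite: Carlet2020, Prop. 54] -/
theorem template_bool {g : (Fin (m + m) → Bool) → Bool} {perm : (Fin m → Bool) → (Fin m → Bool)}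
    {h : (Fin m → Bool) → Bool}
    (hg : ∀ y' y'' : Fin m → Bool, (if g (Fin.append y' y'') then (1 : ZMod 2) else 0) =
      (∑ i, (if y' i then (1 : ZMod 2) else 0) * (if perm y'' i then (1 : ZMod 2) else 0)) +
        (if h y'' then (1 : ZMod 2) else 0)) :
    ∀ y' y'' : Fin m → Bool, g (Fin.append y' y'') =
      ((Finset.univ.filter fun i => y' i && (perm y'') i).card.bodd ^^ h y'') := by
  intro y' y''
  apply toZ_injective
  have key := hg y' y''
  change toZ (g (Fin.append y' y'')) = (∑ i, toZ (y' i) * toZ (perm y'' i)) + toZ (h y'') at key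
  rw [key, toZ_xor, toZ_bdot]
  congr 1
  exact sum_congr rfl fun i _ => (toZ_and _ _).symm

/-! ### Affine covariance of the forrelation -/

/-- **Affine covariance of `Φ`.** Let `e y = L y ⊕ c` with `L x · y = x · Lᵀ y` and `L⁻ᵀ` a two-sided inverse of
`Lᵀ`. Then for `b₀ = b ∘ e` and `a₀ x = a(L⁻ᵀ x) ⊕ (L⁻ᵀ x)·c` one has `Φ(a₀, b₀) = Φ(a, b)`: reindex `y ↦ e y`,
`x ↦ L⁻ᵀ x` in `∑ₓ ∑_y (-1)^{a x} (-1)^{x·y} (-1)^{b y}` and split `(-1)^{L⁻ᵀx·(Ly ⊕ c)} = (-1)^{x·y} (-1)^{L⁻ᵀx·c}`.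
[cite: AaronsonAmbainis2018, §1.1.1] -/
theorem forrelation_transport (a b a₀ b₀ : (Fin n → Bool) → Bool) (e : (Fin n → Bool) ≃ (Fin n → Bool))
    (L Lt Lti : (Fin n → Bool) → (Fin n → Bool)) (cb : Fin n → Bool)
    (he : ∀ y, e y = bxor (L y) cb)
    (hadj : ∀ x y, (univ.filter fun i => L x i && y i).card.bodd = (univ.filter fun i => x i && Lt y i).card.bodd)
    (h1 : ∀ y, Lt (Lti y) = y) (h2 : ∀ y, Lti (Lt y) = y)
    (hb₀ : ∀ y, b₀ y = b (e y))
    (ha₀ : ∀ x, a₀ x = (a (Lti x) ^^ (univ.filter fun i => Lti x i && cb i).card.bodd)) :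
    forrelation a₀ b₀ = forrelation a b := by
  have key : ∀ x y, signOf (a₀ x) * twist x y * signOf (b₀ y) =
      signOf (a (Lti x)) * twist (Lti x) (e y) * signOf (b (e y)) := by
    intro x y
    rw [ha₀, hb₀, signOf_xor, he y, twist_bxor_right, ← signOf_card_bodd (Lti x) cb,
      ← signOf_card_bodd (Lti x) (L y), bdot_comm (Lti x) (L y), hadj, h1, ← signOf_card_bodd x y, bdot_comm x y]
    ring
  let E : (Fin n → Bool) ≃ (Fin n → Bool) := ⟨Lti, Lt, h1, h2⟩
  unfold forrelation
  congr 1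
  rw [← Equiv.sum_comp E (fun x => ∑ y, signOf (a x) * twist x y * signOf (b y))]
  refine sum_congr rfl fun x _ => ?_
  rw [← Equiv.sum_comp e (fun y => signOf (a (E x)) * twist (E x) y * signOf (b y))]
  exact sum_congr rfl fun y _ => key x y

/-! ### The permutation and its inverse have quadratic coordinates -/

/-- **`perm` has quadratic coordinates**: if `b₀` is cubic and `b₀(y', y'') = y'·π(y'') ⊕ h(y'')` then
`y'' ↦ π(y'')ᵢ = b₀(eᵢ, y'') ⊕ b₀(0, y'')` is a first derivative of `b₀` restricted to a block. [cite: Carlet2020, §2.2.2] -/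
theorem isDegLeFun_two_perm {b₀ : (Fin (m + m) → Bool) → Bool} (hb₀ : IsDegLeFun 3 b₀)
    {π : (Fin m → Bool) → (Fin m → Bool)} {h : (Fin m → Bool) → Bool}
    (hbt : ∀ y' y'' : Fin m → Bool, b₀ (Fin.append y' y'') =
      ((Finset.univ.filter fun i => y' i && (π y'') i).card.bodd ^^ h y'')) :
    ∀ i, IsDegLeFun 2 fun y => π y i := by
  intro i
  have hD := stub_derivDegree (m + m) 2 b₀ (Fin.append (fun j => decide (j = i)) zeroVec) hb₀
  have hc := knf_isDegLeFun_comp hD (fun y => Fin.append zeroVec y) (fc_deg_coord_append_left zeroVec)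
  have e : (fun y => π y i) = fun y => (b₀ (Fin.append zeroVec y) ^^
      b₀ (bxor (Fin.append zeroVec y) (Fin.append (fun j => decide (j = i)) zeroVec))) := by
    funext y
    rw [bxor_append, zeroVec_bxor, bxor_zeroVec, hbt, hbt, zeroVec_bdot, bdot_unit, Bool.false_xor]
    cases π y i <;> cases h y <;> rfl
  rw [e]
  exact hc

/-- **`σ = perm⁻¹` has quadratic coordinates**: if `a₀` is cubic and `a₀(x', x'') = x''·σ(x') ⊕ h(σ x') ⊕ c` then
`x' ↦ σ(x')ᵢ = a₀(x', eᵢ) ⊕ a₀(x', 0)` is a first derivative of `a₀` restricted to a block. [cite: Carlet2020, §2.2.2] -/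
theorem isDegLeFun_two_symm {a₀ : (Fin (m + m) → Bool) → Bool} (ha₀ : IsDegLeFun 3 a₀)
    {σ : (Fin m → Bool) → (Fin m → Bool)} {h : (Fin m → Bool) → Bool} {c : Bool}
    (hat : ∀ x' x'' : Fin m → Bool, a₀ (Fin.append x' x'') =
      ((Finset.univ.filter fun i => x'' i && (σ x') i).card.bodd ^^ h (σ x') ^^ c)) :
    ∀ i, IsDegLeFun 2 fun x => σ x i := by
  intro i
  have hD := stub_derivDegree (m + m) 2 a₀ (Fin.append zeroVec (fun j => decide (j = i))) ha₀
  have hc := knf_isDegLeFun_comp hD (fun x => Fin.append x zeroVec) (isDegLeFun_append_left_coord zeroVec)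
  have e : (fun x => σ x i) = fun x => (a₀ (Fin.append x zeroVec) ^^
      a₀ (bxor (Fin.append x zeroVec) (Fin.append zeroVec (fun j => decide (j = i))))) := by
    funext x
    rw [bxor_append, bxor_zeroVec, zeroVec_bxor, hat, hat, zeroVec_bdot, bdot_unit, Bool.false_xor]
    cases σ x i <;> cases h (σ x) <;> cases c <;> rfl
  rw [e]
  exact hc

end Covariance


/-- **No-trap theorem on completed Maiorana–McFarland orbits, from the template case** (stub `stub_noTrapTransport`
of line `dual-pingpong-frame`, crux stmt-QuantumAdvantage-13932): the GROW finder's notions (closed pairs,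
orthogonality, M-subspaces) and the exactness `Φ = ±1` are covariant under the coupled affine change of variables
`y ↦ My ⊕ c` on `b`, `x ↦ M⁻ᵀx` (plus the affine twist `x·M⁻¹c`) on `a`, so the no-trap theorem for template pairs
transports to every exact cubic pair whose `b` lies on a completed Maiorana–McFarland orbit.
[cite: Carlet2020, §2.2.2] [cite: AaronsonAmbainis2018, §1.1.1] -/
theorem stub_noTrapTransport :
    (∀ (m : ℕ) (a b : (Fin (m + m) → Bool) → Bool) (π : (Fin m → Bool) ≃ (Fin m → Bool))
        (h : (Fin m → Bool) → Bool) (c : Bool),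
        (∀ i, IsDegLeFun 2 fun y => π y i) → (∀ i, IsDegLeFun 2 fun x => π.symm x i) →
        IsDegLeFun 3 a → IsDegLeFun 3 b →
        (∀ y' y'' : Fin m → Bool, b (Fin.append y' y'') = (((Finset.univ.filter fun i => y' i && (π y'') i).card.bodd) ^^ h y'')) →
        (∀ x' x'' : Fin m → Bool, a (Fin.append x' x'') =
          (((Finset.univ.filter fun i => x'' i && (π.symm x') i).card.bodd) ^^ h (π.symm x') ^^ c)) →
        ∀ S U : Finset (Fin (m + m) → Bool),
          (zeroVec ∈ S ∧ ∀ x ∈ S, ∀ y ∈ S, bxor x y ∈ S) → (zeroVec ∈ U ∧ ∀ x ∈ U, ∀ y ∈ U, bxor x y ∈ U) →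
          ((∀ s ∈ S, ∀ y : Fin (m + m) → Bool, (fun k => (b zeroVec ^^ b (bxor zeroVec s) ^^ b (bxor zeroVec y) ^^ b (bxor zeroVec (bxor s y))) ^^ (b (fun j => decide (j = k)) ^^ b (bxor (fun j => decide (j = k)) s) ^^ b (bxor (fun j => decide (j = k)) y) ^^ b (bxor (fun j => decide (j = k)) (bxor s y)))) ∈ U) ∧ (∀ s ∈ S, ∃ ℓ ∈ U, ∀ r : Fin (m + m) → Bool, (∀ y z : Fin (m + m) → Bool, ((b z ^^ b (bxor z s) ^^ b (bxor z r) ^^ b (bxor z (bxor s r))) ^^ (b (bxor z y) ^^ b (bxor (bxor z y) s) ^^ b (bxor (bxor z y) r) ^^ b (bxor (bxor z y) (bxor s r)))) = false) → (b r ^^ b (bxor r s) ^^ b zeroVec ^^ b s) = ((Finset.univ.filter fun i => ℓ i && r i).card).bodd)) →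
          ((∀ s ∈ U, ∀ y : Fin (m + m) → Bool, (fun k => (a zeroVec ^^ a (bxor zeroVec s) ^^ a (bxor zeroVec y) ^^ a (bxor zeroVec (bxor s y))) ^^ (a (fun j => decide (j = k)) ^^ a (bxor (fun j => decide (j = k)) s) ^^ a (bxor (fun j => decide (j = k)) y) ^^ a (bxor (fun j => decide (j = k)) (bxor s y)))) ∈ S) ∧ (∀ s ∈ U, ∃ ℓ ∈ S, ∀ r : Fin (m + m) → Bool, (∀ y z : Fin (m + m) → Bool, ((a z ^^ a (bxor z s) ^^ a (bxor z r) ^^ a (bxor z (bxor s r))) ^^ (a (bxor z y) ^^ a (bxor (bxor z y) s) ^^ a (bxor (bxor z y) r) ^^ a (bxor (bxor z y) (bxor s r)))) = false) → (a r ^^ a (bxor r s) ^^ a zeroVec ^^ a s) = ((Finset.univ.filter fun i => ℓ i && r i).card).bodd)) →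
          (∀ s ∈ S, ∀ u ∈ U, ((Finset.univ.filter fun i => s i && u i).card).bodd = false) →
          ∃ V : Finset (Fin (m + m) → Bool), ((zeroVec ∈ V ∧ ∀ x ∈ V, ∀ y ∈ V, bxor x y ∈ V) ∧ (((V).card : ℝ) ^ 2 = (2 : ℝ) ^ (m + m)) ∧ ∀ u ∈ V, ∀ v ∈ V, ∀ x, (b x ^^ b (bxor x u) ^^ b (bxor x v) ^^ b (bxor x (bxor u v))) = false) ∧ S ⊆ V ∧ (∀ s ∈ V, ∀ u ∈ U, ((Finset.univ.filter fun i => s i && u i).card).bodd = false)) →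
    ∀ (m : ℕ) (a b : (Fin (m + m) → Bool) → Bool),
        IsDegLeFun 3 a → IsDegLeFun 3 b → (forrelation a b = 1 ∨ forrelation a b = -1) →
        (∃ e : (Fin (m + m) → Bool) ≃ (Fin (m + m) → Bool),
          (∃ M : Matrix (Fin (m + m)) (Fin (m + m)) (ZMod 2), ∃ c : Fin (m + m) → ZMod 2,
            ∀ y i, (if e y i then (1 : ZMod 2) else 0) = (M.mulVec (fun j => if y j then (1 : ZMod 2) else 0) + c) i) ∧
          ∃ perm : (Fin m → Bool) ≃ (Fin m → Bool), ∃ h : (Fin m → Bool) → Bool, ∀ y' y'' : Fin m → Bool,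
            (if b (e (Fin.append y' y'')) then (1 : ZMod 2) else 0) =
              (∑ i, (if y' i then (1 : ZMod 2) else 0) * (if perm y'' i then (1 : ZMod 2) else 0)) +
                (if h y'' then (1 : ZMod 2) else 0)) →
        ∀ S U : Finset (Fin (m + m) → Bool),
          (zeroVec ∈ S ∧ ∀ x ∈ S, ∀ y ∈ S, bxor x y ∈ S) → (zeroVec ∈ U ∧ ∀ x ∈ U, ∀ y ∈ U, bxor x y ∈ U) →
          ((∀ s ∈ S, ∀ y : Fin (m + m) → Bool, (fun k => (b zeroVec ^^ b (bxor zeroVec s) ^^ b (bxor zeroVec y) ^^ b (bxor zeroVec (bxor s y))) ^^ (b (fun j => decide (j = k)) ^^ b (bxor (fun j => decide (j = k)) s) ^^ b (bxor (fun j => decide (j = k)) y) ^^ b (bxor (fun j => decide (j = k)) (bxor s y)))) ∈ U) ∧ (∀ s ∈ S, ∃ ℓ ∈ U, ∀ r : Fin (m + m) → Bool, (∀ y z : Fin (m + m) → Bool, ((b z ^^ b (bxor z s) ^^ b (bxor z r) ^^ b (bxor z (bxor s r))) ^^ (b (bxor z y) ^^ b (bxor (bxor z y) s) ^^ b (bxor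 (bxor z y) r) ^^ b (bxor (bxor z y) (bxor s r)))) = false) → (b r ^^ b (bxor r s) ^^ b zeroVec ^^ b s) = ((Finset.univ.filter fun i => ℓ i && r i).card).bodd)) →
          ((∀ s ∈ U, ∀ y : Fin (m + m) → Bool, (fun k => (a zeroVec ^^ a (bxor zeroVec s) ^^ a (bxor zeroVec y) ^^ a (bxor zeroVec (bxor s y))) ^^ (a (fun j => decide (j = k)) ^^ a (bxor (fun j => decide (j = k)) s) ^^ a (bxor (fun j => decide (j = k)) y) ^^ a (bxor (fun j => decide (j = k)) (bxor s y)))) ∈ S) ∧ (∀ s ∈ U, ∃ ℓ ∈ S, ∀ r : Fin (m + m) → Bool, (∀ y z : Fin (m + m) → Bool, ((a z ^^ a (bxor z s) ^^ a (bxor z r) ^^ a (bxor z (bxor s r))) ^^ (a (bxor z y) ^^ a (bxor (bxor z y) s) ^^ a (bxor (bxor z y) r) ^^ a (bxor (bxor z y) (bxor s r)))) = false) → (a r ^^ a (bxor r s) ^^ a zeroVec ^^ a s) = ((Finset.univ.filter fun i => ℓ i && r i).card).bodd)) →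
          (∀ s ∈ S, ∀ u ∈ U, ((Finset.univ.filter fun i => s i && u i).card).bodd = false) →
          ∃ V : Finset (Fin (m + m) → Bool), ((zeroVec ∈ V ∧ ∀ x ∈ V, ∀ y ∈ V, bxor x y ∈ V) ∧ (((V).card : ℝ) ^ 2 = (2 : ℝ) ^ (m + m)) ∧ ∀ u ∈ V, ∀ v ∈ V, ∀ x, (b x ^^ b (bxor x u) ^^ b (bxor x v) ^^ b (bxor x (bxor u v))) = false) ∧ S ⊆ V ∧ (∀ s ∈ V, ∀ u ∈ U, ((Finset.univ.filter fun i => s i && u i).card).bodd = false) := by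
  intro NTT m a b ha hb hΦ horbit S U hS hU hclb hcla ho
  obtain ⟨e, ⟨M, c, hM⟩, perm, h, hbt⟩ := horbit
  -- Step 1: the affine bijection `e y = L y ⊕ cb`, its inverse, adjoint and inverse adjoint
  obtain ⟨cb, hcbdef⟩ : ∃ cb : Fin (m + m) → Bool, cb = fun i => decide (c i = 1) := ⟨_, rfl⟩
  obtain ⟨L, hLdef⟩ : ∃ L : (Fin (m + m) → Bool) → (Fin (m + m) → Bool), ∀ y, L y = bxor (e y) cb :=
    ⟨_, fun _ => rfl⟩
  have hcc : ∀ x : Fin (m + m) → Bool, bxor (bxor x cb) cb = x := fun x => by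
    funext i
    show ((x i ^^ cb i) ^^ cb i) = x i
    rw [Bool.xor_assoc, Bool.xor_self, Bool.xor_false]
  have hL : ∀ x y, L (bxor x y) = bxor (L x) (L y) := by
    intro x y
    rw [hLdef, hLdef, hLdef, hcbdef]
    exact additive_linear_part e M c hM x y
  have he : ∀ y, e y = bxor (L y) cb := fun y => by rw [hLdef, hcc]
  obtain ⟨Li, hLidef⟩ : ∃ Li : (Fin (m + m) → Bool) → (Fin (m + m) → Bool), ∀ x, Li x = e.symm (bxor x cb) :=
    ⟨_, fun _ => rfl⟩
  have hLLi : ∀ x, L (Li x) = x := fun x => by rw [hLdef, hLidef, Equiv.apply_symm_apply, hcc]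
  have hLiL : ∀ y, Li (L y) = y := fun y => by rw [hLidef, hLdef, hcc, Equiv.symm_apply_apply]
  have hLi : ∀ x y, Li (bxor x y) = bxor (Li x) (Li y) := inverse_additive hL hLLi hLiL
  have hLinj : Function.Injective L := fun x y hxy => by
    have := congrArg Li hxy
    rwa [hLiL, hLiL] at this
  obtain ⟨Lt, hadj⟩ := exists_adjoint L hL
  obtain ⟨Lti, hadji⟩ := exists_adjoint Li hLi
  have hLt : ∀ x y, Lt (bxor x y) = bxor (Lt x) (Lt y) := adjoint_additive hadj
  have hLti : ∀ x y, Lti (bxor x y) = bxor (Lti x) (Lti y) := adjoint_additive hadji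
  have h1 : ∀ y, Lt (Lti y) = y := fun y => eq_of_bdot_eq fun x => by rw [← hadj, ← hadji, hLiL]
  have h2 : ∀ y, Lti (Lt y) = y := fun y => eq_of_bdot_eq fun x => by rw [← hadji, ← hadj, hLLi]
  have hadj' : ∀ x y, (univ.filter fun i => Lti x i && y i).card.bodd =
      (univ.filter fun i => x i && Li y i).card.bodd := fun x y => by
    rw [bdot_comm, ← hadji, bdot_comm]
  -- Step 2: the transported pair `b₀ = b ∘ e`, `a₀ = a ∘ L⁻ᵀ ⊕ (L⁻ᵀ ·)·cb`
  obtain ⟨b₀, hb₀⟩ : ∃ b₀ : (Fin (m + m) → Bool) → Bool, ∀ y, b₀ y = b (e y) := ⟨_, fun _ => rfl⟩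
  obtain ⟨a₀, ha₀⟩ : ∃ a₀ : (Fin (m + m) → Bool) → Bool,
      ∀ x, a₀ x = (a (Lti x) ^^ (univ.filter fun i => Lti x i && cb i).card.bodd) := ⟨_, fun _ => rfl⟩
  have hb₀' : ∀ y, b₀ y = (b (bxor (L y) cb) ^^ false) := fun y => by rw [hb₀, he, Bool.xor_false]
  have ha₀' : ∀ x, a₀ x = (a (bxor (Lti x) zeroVec) ^^ (univ.filter fun i => Lti x i && cb i).card.bodd) :=
    fun x => by rw [ha₀, bxor_zeroVec]
  have hlam : ∀ x y, (univ.filter fun i => Lti (bxor x y) i && cb i).card.bodd =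
      ((univ.filter fun i => Lti x i && cb i).card.bodd ^^ (univ.filter fun i => Lti y i && cb i).card.bodd) :=
    fun x y => by rw [hLti, bdot_bxor_left]
  -- degrees
  have hb₀3 : IsDegLeFun 3 b₀ := by
    have e1 : b₀ = fun y => b (bxor (L y) cb) := funext fun y => by rw [hb₀, he]
    rw [e1]
    exact isDegLeFun_comp_affine hb hL cb
  have ha₀3 : IsDegLeFun 3 a₀ := by
    rw [show a₀ = fun x => (a (bxor (Lti x) zeroVec) ^^ (univ.filter fun i => Lti x i && cb i).card.bodd) from
      funext ha₀']
    exact (knf_isDegLeFun_xor' (isDegLeFun_comp_affine ha hLti zeroVec) (isDegLeFun_one_of_additive hlam)).mono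
      (by norm_num)
  -- template shape of `b₀`, exactness, dual shape of `a₀`, quadratic coordinates
  have hb₀t : ∀ y' y'' : Fin m → Bool, b₀ (Fin.append y' y'') =
      (((Finset.univ.filter fun i => y' i && (perm y'') i).card.bodd) ^^ h y'') := fun y' y'' => by
    rw [hb₀]
    exact template_bool (g := fun y => b (e y)) hbt y' y''
  have hperm2 : ∀ i, IsDegLeFun 2 fun y => perm y i := isDegLeFun_two_perm hb₀3 hb₀t
  have hΦ₀ : forrelation a₀ b₀ = 1 ∨ forrelation a₀ b₀ = -1 := by
    rw [forrelation_transport a b a₀ b₀ e L Lt Lti cb he hadj h1 h2 hb₀ ha₀]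
    exact hΦ
  have ha₀t := stub_dualShape m a₀ b₀ perm h hb₀t hΦ₀
  have hsymm2 : ∀ i, IsDegLeFun 2 fun x => perm.symm x i := isDegLeFun_two_symm ha₀3 ha₀t
  -- Step 3: the transported subspaces `S₀ = L⁻¹ S`, `U₀ = Lᵀ U`
  have hS₀ := isSub_image hLi hS
  have hU₀ := isSub_image hLt hU
  have hA : ∀ s ∈ S.image Li, L s ∈ S := fun s hs => by
    obtain ⟨s', hs', rfl⟩ := mem_image.1 hs
    rw [hLLi]
    exact hs'
  have hA' : ∀ u ∈ U.image Lt, Lti u ∈ U := fun u hu => by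
    obtain ⟨u', hu', rfl⟩ := mem_image.1 hu
    rw [h2]
    exact hu'
  have hclb₀ := closedF_transport b b₀ hb L Lt cb (fun _ => false) hL (fun y => ⟨Li y, hLLi y⟩) hadj
    (fun _ _ => rfl) hb₀' S U (S.image Li) (U.image Lt) hA (fun ℓ hℓ => mem_image_of_mem Lt hℓ) hclb
  have hcla₀ := closedF_transport a a₀ ha Lti Li zeroVec (fun x => (univ.filter fun i => Lti x i && cb i).card.bodd)
    hLti (fun y => ⟨Lt y, h2 y⟩) hadj' hlam ha₀' U S (U.image Lt) (S.image Li) hA'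
    (fun ℓ hℓ => mem_image_of_mem Li hℓ) hcla
  have ho₀ : ∀ s ∈ S.image Li, ∀ u ∈ U.image Lt, ((Finset.univ.filter fun i => s i && u i).card).bodd = false := by
    intro s hs u hu
    obtain ⟨s', hs', rfl⟩ := mem_image.1 hs
    obtain ⟨u', hu', rfl⟩ := mem_image.1 hu
    rw [← hadj, hLLi]
    exact ho s' hs' u' hu'
  -- Step 4: apply the template theorem and map the M-subspace back by `L`
  obtain ⟨V₀, ⟨hV₀sub, hV₀card, hV₀flat⟩, hSV₀, hV₀U⟩ :=
    NTT m a₀ b₀ perm h _ hperm2 hsymm2 ha₀3 hb₀3 hb₀t ha₀t (S.image Li) (U.image Lt) hS₀ hU₀ hclb₀ hcla₀ ho₀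
  refine ⟨V₀.image L, ⟨isSub_image hL hV₀sub, ?_, ?_⟩, ?_, ?_⟩
  · rw [card_image_of_injective _ hLinj]
    exact hV₀card
  · intro u hu v hv x
    obtain ⟨u₀, hu₀, rfl⟩ := mem_image.1 hu
    obtain ⟨v₀, hv₀, rfl⟩ := mem_image.1 hv
    obtain ⟨D, hD⟩ : ∃ D : (Fin (m + m) → Bool) → (Fin (m + m) → Bool) → (Fin (m + m) → Bool) → Bool,
        ∀ u v x, D u v x = (b x ^^ b (bxor x u) ^^ b (bxor x v) ^^ b (bxor x (bxor u v))) := ⟨_, fun _ _ _ => rfl⟩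
    obtain ⟨D₀, hD₀⟩ : ∃ D₀ : (Fin (m + m) → Bool) → (Fin (m + m) → Bool) → (Fin (m + m) → Bool) → Bool,
        ∀ u v x, D₀ u v x = (b₀ x ^^ b₀ (bxor x u) ^^ b₀ (bxor x v) ^^ b₀ (bxor x (bxor u v))) :=
      ⟨_, fun _ _ _ => rfl⟩
    have key := hV₀flat u₀ hu₀ v₀ hv₀ (e.symm x)
    have HD := D2_transport hL (lam := fun _ => false) (fun _ _ => rfl) hb₀' D D₀ hD hD₀ u₀ v₀ (e.symm x)
    rw [← he, Equiv.apply_symm_apply] at HD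
    rw [← hD₀, HD, hD] at key
    exact key
  · intro s hs
    exact mem_image.2 ⟨Li s, hSV₀ (mem_image_of_mem Li hs), hLLi s⟩
  · intro x hx u hu
    obtain ⟨v₀, hv₀, rfl⟩ := mem_image.1 hx
    rw [hadj]
    exact hV₀U v₀ hv₀ (Lt u) (mem_image_of_mem Lt hu)

end Summit.QuantumAdvantage.QuantumAdvantage.Theorems.SignedExactCubicForrelationNotPrBPP

end
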